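import Summits.Ventures.Crystal3D.Bulk.HullRotSysCornerSign
import Summits.Ventures.Crystal3D.Bulk.RotSysEarSplice
import Summits.Ventures.Crystal3D.Bulk.ConvexPositionGluing
import HarnessLib

/-!
# Face walks of a sub-map of the hull fan: vertices, period, convexity, left turns, monotone
# corners (route 1 of `HOME/lean/lemmaL/DESIGN.md`, R1.7 — bookkeeping for the ear induction)

HONEST FRAMING. Part of the venture `Summits/Ventures/Crystal3D` (cell `pub-crystal3d`, phase 2;
seat p3), generic and configuration-free: `X` is any finite set of unit vectors of `ℝ³` with `0`
interior to its hull, `σ_H = rot`, `α = inv` its hull rotation system (`Bulk/HullRotSys*.lean`);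
nothing here mentions GAP(1.26). For an `α`-closed dart set `S ⊆ hullDarts X` the faces of the
sub-map are the cycles of `φ_S` (typer-bulk-2's `RotSys.phi`); the WALK of the face through `d`
visits the vertices `faceVertex S d t = (φ_S^t d).1.1`, `t < facePeriod S d`.

* `faceDart`, `faceVertex`, `facePeriod`, **`FaceConvex`** (all increasingly indexed triples of
  the antipodal walk positively oriented = `orient3 vᵢ vⱼ v_k < 0` along the walk,
  `faceConvex_iff_orient3_neg`), periodicity / shift lemmas, `FaceConvex.shift/of_shift`;
* **`orient3_walk_pos`** — all corners `< π` ⇒ every turn of every walk is a left turn seen from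
  outside (`0 < orient3 v_{t+1} v_t v_{t+2}`; the link lemma `orient3_pos_of_cornerAt_lt_pi`);
* `cornerAt_mono` — corners only shrink when darts are added;
* `EarsUp S` — the ear hypothesis of the induction (`Bulk/HullSubmapConvex.lean`), discharged for
  covering connected sub-maps in `Bulk/HullSubmapEars.lean`; `faceConvex_of_forall_phi_eq` — a face
  untouched by an added edge keeps its walk; `rot_inv_rot_inv_rot_inv` (`φ_H³ = 1`).
-/

noncomputable section

namespace Summit.Ventures.Crystal3D

namespace HullRotSys

open Literature.Geometry.DiscreteGeometry Finset Equiv Real InnerProductGeometry Function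

variable {X : Finset (EuclideanSpace ℝ (Fin 3))}

/-! ## Face walks -/

/-- The `t`-th dart of the face walk of the sub-map `S` starting at `d`: `φ_S^t d`. -/
def faceDart (hX1 : ∀ y ∈ X, ‖y‖ = 1)
    (h0 : (0 : EuclideanSpace ℝ (Fin 3)) ∈ interior (convexHull ℝ (X : Set _)))
    (S : Finset ↥(hullDarts X)) (d : ↥(hullDarts X)) (t : ℕ) : ↥(hullDarts X) :=
  (RotSys.phi (rot hX1 h0) (inv X) S ^ t) d

/-- The `t`-th VERTEX of the face walk: the tail of its `t`-th dart. -/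
def faceVertex (hX1 : ∀ y ∈ X, ‖y‖ = 1)
    (h0 : (0 : EuclideanSpace ℝ (Fin 3)) ∈ interior (convexHull ℝ (X : Set _)))
    (S : Finset ↥(hullDarts X)) (d : ↥(hullDarts X)) (t : ℕ) : EuclideanSpace ℝ (Fin 3) :=
  (faceDart hX1 h0 S d t).1.1

/-- The PERIOD of the face walk (number of darts = number of corners of the face). -/
def facePeriod (hX1 : ∀ y ∈ X, ‖y‖ = 1)
    (h0 : (0 : EuclideanSpace ℝ (Fin 3)) ∈ interior (convexHull ℝ (X : Set _)))
    (S : Finset ↥(hullDarts X)) (d : ↥(hullDarts X)) : ℕ :=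
  minimalPeriod (RotSys.phi (rot hX1 h0) (inv X) S) d

/-- **Convexity of the face walk** (in the orientation of the walk, which is clockwise seen from
outside, hence stated on the antipodal vectors): all increasingly indexed triples of
`−faceVertex` are positively oriented. -/
def FaceConvex (hX1 : ∀ y ∈ X, ‖y‖ = 1)
    (h0 : (0 : EuclideanSpace ℝ (Fin 3)) ∈ interior (convexHull ℝ (X : Set _)))
    (S : Finset ↥(hullDarts X)) (d : ↥(hullDarts X)) : Prop :=
  ∀ i j k : ℕ, i < j → j < k → k < facePeriod hX1 h0 S d →
    0 < orient3 (-faceVertex hX1 h0 S d i) (-faceVertex hX1 h0 S d j) (-faceVertex hX1 h0 S d k)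

variable {hX1 : ∀ y ∈ X, ‖y‖ = 1}
  {h0 : (0 : EuclideanSpace ℝ (Fin 3)) ∈ interior (convexHull ℝ (X : Set _))}

/-- `orient3` is odd: `orient3 (−a) (−b) (−c) = −orient3 a b c`. -/
theorem orient3_neg_neg_neg (a b c : EuclideanSpace ℝ (Fin 3)) :
    orient3 (-a) (-b) (-c) = -orient3 a b c := by
  rw [show -a = (-1 : ℝ) • a by simp, show -b = (-1 : ℝ) • b by simp, show -c = (-1 : ℝ) • c by simp,
    orient3_smul_left, orient3_smul_mid, orient3_smul_right]
  ring

/-- Convexity of the walk, in the direct form: `orient3 vᵢ vⱼ v_k < 0` for `i < j < k`. -/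
theorem faceConvex_iff_orient3_neg (S : Finset ↥(hullDarts X)) (d : ↥(hullDarts X)) :
    FaceConvex hX1 h0 S d ↔ ∀ i j k : ℕ, i < j → j < k → k < facePeriod hX1 h0 S d →
      orient3 (faceVertex hX1 h0 S d i) (faceVertex hX1 h0 S d j) (faceVertex hX1 h0 S d k) < 0 := by
  unfold FaceConvex
  simp only [orient3_neg_neg_neg, neg_pos]

/-! ## Walk bookkeeping -/

/-- Unfolding `faceDart` one step. -/
theorem faceDart_succ (S : Finset ↥(hullDarts X)) (d : ↥(hullDarts X)) (t : ℕ) :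
    faceDart hX1 h0 S d (t + 1) = RotSys.phi (rot hX1 h0) (inv X) S (faceDart hX1 h0 S d t) := by
  unfold faceDart; rw [pow_succ', Perm.mul_apply]

/-- `faceDart … 0 = d`. -/
theorem faceDart_zero (S : Finset ↥(hullDarts X)) (d : ↥(hullDarts X)) :
    faceDart hX1 h0 S d 0 = d := by
  unfold faceDart; rw [pow_zero, Perm.one_apply]

/-- The darts of the walk are in `S` (for `α`-closed `S ∋ d`). -/
theorem faceDart_mem {S : Finset ↥(hullDarts X)} (hS : RotSys.IsClosed (inv X) S)
    {d : ↥(hullDarts X)} (hd : d ∈ S) (t : ℕ) : faceDart hX1 h0 S d t ∈ S :=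
  RotSys.phi_pow_apply_mem hS hd t

/-- **Head = next tail**: the head of the `t`-th dart is the `(t+1)`-st vertex. -/
theorem faceDart_snd (S : Finset ↥(hullDarts X)) (d : ↥(hullDarts X)) (t : ℕ) :
    (faceDart hX1 h0 S d t).1.2 = faceVertex hX1 h0 S d (t + 1) := by
  unfold faceVertex
  rw [faceDart_succ, RotSys.phi_apply]
  set x := faceDart hX1 h0 S d t
  by_cases hx : inv X x ∈ S
  · rw [RotSys.induce_apply_of_mem _ hx, rot_pow_apply_fst, inv_apply_val]
    rfl
  · rw [RotSys.induce_apply_of_not_mem _ hx, inv_apply_val]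
    rfl

/-- The walk is periodic. -/
theorem faceDart_add_period (S : Finset ↥(hullDarts X)) (d : ↥(hullDarts X)) (t : ℕ) :
    faceDart hX1 h0 S d (t + facePeriod hX1 h0 S d) = faceDart hX1 h0 S d t := by
  unfold faceDart facePeriod
  exact RotSys.pow_add_minimalPeriod_apply _ d t

/-- The vertices are periodic. -/
theorem faceVertex_add_period (S : Finset ↥(hullDarts X)) (d : ↥(hullDarts X)) (t : ℕ) :
    faceVertex hX1 h0 S d (t + facePeriod hX1 h0 S d) = faceVertex hX1 h0 S d t := by
  unfold faceVertex; rw [faceDart_add_period]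

/-- The vertices only depend on the index modulo the period. -/
theorem faceVertex_mod (S : Finset ↥(hullDarts X)) (d : ↥(hullDarts X)) (t : ℕ) :
    faceVertex hX1 h0 S d (t % facePeriod hX1 h0 S d) = faceVertex hX1 h0 S d t := by
  unfold faceVertex faceDart facePeriod
  rw [RotSys.pow_apply_eq_iterate, RotSys.pow_apply_eq_iterate, iterate_mod_minimalPeriod_eq]

/-- The period is positive. -/
theorem facePeriod_pos (S : Finset ↥(hullDarts X)) (d : ↥(hullDarts X)) :
    0 < facePeriod hX1 h0 S d :=
  RotSys.minimalPeriod_pos_perm _ d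

/-- Shifting the start along the walk shifts the vertices … -/
theorem faceVertex_shift (S : Finset ↥(hullDarts X)) (d : ↥(hullDarts X)) (r t : ℕ) :
    faceVertex hX1 h0 S (faceDart hX1 h0 S d r) t = faceVertex hX1 h0 S d (t + r) := by
  unfold faceVertex faceDart
  rw [← Perm.mul_apply, ← pow_add]

/-- … and keeps the period. -/
theorem facePeriod_shift (S : Finset ↥(hullDarts X)) (d : ↥(hullDarts X)) (r : ℕ) :
    facePeriod hX1 h0 S (faceDart hX1 h0 S d r) = facePeriod hX1 h0 S d := by
  unfold facePeriod faceDart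
  rw [RotSys.pow_apply_eq_iterate]
  exact minimalPeriod_apply_iterate ((RotSys.phi (rot hX1 h0) (inv X) S).injective.mem_periodicPts d) r

/-- **Convexity is a property of the face, not of the start dart**: it transfers along the walk. -/
theorem FaceConvex.shift {S : Finset ↥(hullDarts X)} {d : ↥(hullDarts X)}
    (h : FaceConvex hX1 h0 S d) (r : ℕ) : FaceConvex hX1 h0 S (faceDart hX1 h0 S d r) := by
  intro i j k hij hjk hk
  rw [facePeriod_shift] at hk
  have hrot := convexPos_rotate h r i j k hij hjk hk
  rw [faceVertex_shift, faceVertex_shift, faceVertex_shift, ← faceVertex_mod S d (i + r),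
    ← faceVertex_mod S d (j + r), ← faceVertex_mod S d (k + r)]
  exact hrot

/-- … and back. -/
theorem FaceConvex.of_shift {S : Finset ↥(hullDarts X)} {d : ↥(hullDarts X)} (r : ℕ)
    (h : FaceConvex hX1 h0 S (faceDart hX1 h0 S d r)) : FaceConvex hX1 h0 S d := by
  -- shift further by `m·r − r ≡ −r`
  set m := facePeriod hX1 h0 S d with hm
  have hpos : 0 < m := facePeriod_pos S d
  have h2 := h.shift (m * r - r)
  have heq : faceDart hX1 h0 S (faceDart hX1 h0 S d r) (m * r - r) = d := by
    unfold faceDart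
    rw [← Perm.mul_apply, ← pow_add, show m * r - r + r = m * r by
      have : r ≤ m * r := Nat.le_mul_of_pos_left r hpos
      rw [Nat.sub_add_cancel this]]
    have := RotSys.pow_apply_eq_iterate (RotSys.phi (rot hX1 h0) (inv X) S) (m * r) d
    rw [this]
    have hp : IsPeriodicPt (RotSys.phi (rot hX1 h0) (inv X) S) (m * r) d :=
      (isPeriodicPt_minimalPeriod _ d).mul_const r
    exact hp
  rw [heq] at h2
  exact h2

/-! ## Every corner `< π` makes every turn of the walk a left turn (seen from outside) -/

/-- **The left-turn fact**: if all corners of the closed sub-map `S` are `< π`, then along any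
face walk `0 < orient3 v_{t+1} v_t v_{t+2}` (link lemma at the dart `α f_t`). -/
theorem orient3_walk_pos {S : Finset ↥(hullDarts X)} (hS : RotSys.IsClosed (inv X) S)
    (hlt : ∀ z ∈ S, RotSys.cornerAt (rot hX1 h0) (dartWeight X) S z < π) {d : ↥(hullDarts X)}
    (hd : d ∈ S) (t : ℕ) :
    0 < orient3 (faceVertex hX1 h0 S d (t + 1)) (faceVertex hX1 h0 S d t)
      (faceVertex hX1 h0 S d (t + 2)) := by
  set z := inv X (faceDart hX1 h0 S d t) with hz
  have hzS : z ∈ S := hS _ (faceDart_mem hS hd t)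
  have h := orient3_pos_of_cornerAt_lt_pi (hX1 := hX1) (h0 := h0) S hzS (hlt z hzS)
  have h1 : z.1.1 = faceVertex hX1 h0 S d (t + 1) := by
    rw [hz, inv_apply_val, Prod.fst_swap, faceDart_snd]
  have h2 : z.1.2 = faceVertex hX1 h0 S d t := by
    rw [hz, inv_apply_val, Prod.snd_swap]; rfl
  have h3 : (RotSys.induce (rot hX1 h0) S z).1.2 = faceVertex hX1 h0 S d (t + 2) := by
    rw [hz, ← RotSys.phi_apply, ← faceDart_succ, faceDart_snd]
  rw [h1, h2, h3] at h
  exact h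

/-! ## Corners only shrink when darts are added -/

/-- Fan angles are nonnegative. -/
theorem dartWeight_nonneg (d : ↥(hullDarts X)) : 0 ≤ dartWeight X d := by
  rw [dartWeight_apply]; exact angle_nonneg _ _

/-- Corners are nonnegative. -/
theorem cornerAt_nonneg (S : Finset ↥(hullDarts X)) (z : ↥(hullDarts X)) :
    0 ≤ RotSys.cornerAt (rot hX1 h0) (dartWeight X) S z := by
  unfold RotSys.cornerAt
  exact Finset.sum_nonneg fun m _ => dartWeight_nonneg _

/-- **Monotonicity**: enlarging the dart set can only shrink the corner at a dart of the smaller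
set. -/
theorem cornerAt_mono {S S' : Finset ↥(hullDarts X)} (hsub : S ⊆ S') {z : ↥(hullDarts X)}
    (hz : z ∈ S) :
    RotSys.cornerAt (rot hX1 h0) (dartWeight X) S' z ≤ RotSys.cornerAt (rot hX1 h0) (dartWeight X) S z
      := by
  unfold RotSys.cornerAt
  obtain ⟨hr0, hrS⟩ := RotSys.retTime_spec (rot hX1 h0) hz
  have hle : RotSys.retTime (rot hX1 h0) S' z ≤ RotSys.retTime (rot hX1 h0) S z :=
    RotSys.retTime_le_of_mem _ (hsub hz) hr0 (hsub hrS)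
  exact Finset.sum_le_sum_of_subset_of_nonneg (Finset.range_mono hle)
    (fun m _ _ => dartWeight_nonneg _)

/-! ## The hypothesis on ears -/

/-- `EarsUp S`: in every `α`-closed super-map of `S` with all corners `< π` that has a face of
period `≥ 4`, SOME face of period `≥ 4` has an EAR: a dart `e` whose face successor is its ambient
(fan-triangle) successor, `φ e = σ_H (α e)`. (True when `S` covers every vertex of `X` and is
connected — a fan-triangle count, `Bulk/HullSubmapEars.lean`; taken as a hypothesis here.) -/
def EarsUp (hX1 : ∀ y ∈ X, ‖y‖ = 1)
    (h0 : (0 : EuclideanSpace ℝ (Fin 3)) ∈ interior (convexHull ℝ (X : Set _)))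
    (S : Finset ↥(hullDarts X)) : Prop :=
  ∀ S' : Finset ↥(hullDarts X), S ⊆ S' → RotSys.IsClosed (inv X) S' →
    (∀ z ∈ S', RotSys.cornerAt (rot hX1 h0) (dartWeight X) S' z < π) →
    (∃ d ∈ S', 4 ≤ facePeriod hX1 h0 S' d) →
      ∃ e ∈ S', 4 ≤ facePeriod hX1 h0 S' e ∧
        RotSys.phi (rot hX1 h0) (inv X) S' e = rot hX1 h0 (inv X e)

/-- `EarsUp` is inherited by super-maps. -/
theorem EarsUp.mono {S S' : Finset ↥(hullDarts X)} (h : EarsUp hX1 h0 S) (hsub : S ⊆ S') :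
    EarsUp hX1 h0 S' :=
  fun S'' hsub' => h S'' (hsub.trans hsub')

/-! ## Faces untouched by an added edge keep their walk -/

/-- If the face permutations of `S ⊆ S'` agree along the whole walk of `d` in `S`, the walks,
periods and hence convexity agree. -/
theorem faceConvex_of_forall_phi_eq {S S' : Finset ↥(hullDarts X)} {d : ↥(hullDarts X)}
    (heq : ∀ t, RotSys.phi (rot hX1 h0) (inv X) S' (faceDart hX1 h0 S d t) =
      RotSys.phi (rot hX1 h0) (inv X) S (faceDart hX1 h0 S d t))
    (h : FaceConvex hX1 h0 S' d) : FaceConvex hX1 h0 S d := by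
  have hdart : ∀ t, faceDart hX1 h0 S' d t = faceDart hX1 h0 S d t := by
    intro t
    induction t with
    | zero => rw [faceDart_zero, faceDart_zero]
    | succ t ih => rw [faceDart_succ, faceDart_succ, ih, heq]
  have hper : facePeriod hX1 h0 S' d = facePeriod hX1 h0 S d := by
    unfold facePeriod
    refine RotSys.minimalPeriod_eq_of_first_return _ d (facePeriod_pos S d) ?_ ?_
    · have := hdart (facePeriod hX1 h0 S d)
      unfold faceDart facePeriod at this
      rw [this]
      exact RotSys.pow_minimalPeriod_apply _ d
    · intro k hk0 hk heqk
      have h1 := hdart k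
      unfold faceDart at h1
      rw [h1] at heqk
      have := RotSys.pow_apply_injOn _ d (i := k) (j := 0) hk (facePeriod_pos S d)
        (by rw [pow_zero, Perm.one_apply]; exact heqk)
      omega
  intro i j k hij hjk hk
  have hv : ∀ t, faceVertex hX1 h0 S d t = faceVertex hX1 h0 S' d t := fun t => by
    unfold faceVertex; rw [hdart]
  rw [hv, hv, hv]
  exact h i j k hij hjk (by rw [hper]; exact hk)

/-! ## The ambient face permutation has order three -/

/-- The ambient face permutation is the fan-triangle walk: `φ_univ x = σ_H (α x)`, of order `3`. -/
theorem rot_inv_rot_inv_rot_inv (x : ↥(hullDarts X)) :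
    rot hX1 h0 (inv X (rot hX1 h0 (inv X (rot hX1 h0 (inv X x))))) = x := by
  have h3 := phi_univ_pow_three (hX1 := hX1) (h0 := h0) x
  have hφ : ∀ y : ↥(hullDarts X), RotSys.phi (rot hX1 h0) (inv X) univ y = rot hX1 h0 (inv X y) := by
    intro y; rw [RotSys.phi_apply, induce_univ_apply]
  rw [pow_succ, pow_two, Perm.mul_apply, Perm.mul_apply, hφ, hφ, hφ] at h3
  exact h3

end HullRotSys

end Summit.Ventures.Crystal3D
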